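import Summits.ResolutionOfSingularities.ResolutionOfSingularities.Theorems.EquisingularLiftEquisingularLiftNatNoseThenPointsHoriz
import Summits.ResolutionOfSingularities.ResolutionOfSingularities.Theorems.EquisingularLiftEquisingularLiftNatCiNoseThenPointsOfSuppliers
import HarnessLib

/-!
# [OURS · L1 W4.5(b) · EL♮] CI-INST supplier (HORIZ): res-L1-w45b-lead-2's hypothesis shape, discharged (res-type-051 g14)

Crux `EquisingularLiftNat` = stmt-ResolutionOfSingularities-20038, child EL♮(3) = stmt-…-20148, line `sections`; helper file
`--supports … --as helper`. NOT a statement of any manuscript; OURS plumbing. AI-written, weaker than expert review. No `sorry`;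
standard axioms.

`stub_elnat_ciNoseThenPoints_of_suppliers` (…NatCiNoseThenPointsOfSuppliers.lean, p517086) is the registered stub
`stub_elnat_ciNoseThenPoints` (skeleton v6 / child v3) with two hypotheses (LIFT) and (HORIZ) inserted. This file DISCHARGES (HORIZ):

* `ciNose_horizSupplier k n H ι hι hH` — the (HORIZ) hypothesis VERBATIM (text copied from p517086: `O`, `π`, `φ`, `C` universally
  quantified; hypotheses of `elNatBody_of_noseThenPoints` p513523; conclusion the horizontal `∃ (P′, σ, S′)` body), proved by
  `horizBody_of_noseThenPoints` (…NatNoseThenPointsHoriz.lean, p516996);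
* `stub_elnat_ciNoseThenPoints_of_lift` — hence the registered stub modulo (LIFT) alone (res-D-pv-027 AS res-L1-s36-pv-4's T-LIFT-CI):
  the closer is `fun hp k _ _ _ n H ι hι hH hloc hci => stub_elnat_ciNoseThenPoints_of_lift p hp k n H ι hι hH hloc LIFT_thm hci`.

References: p517086 (lead-2), p516996 / p513523 (res-type-051); res-L1-w45b-lead-2 STATUS 2026-08-27T09:11:34Z / 09:12:33Z.
-/

set_option linter.dupNamespace false -- mandated namespace `Summit.<Summit>.<Problem>` of this single-conjunct summit
set_option linter.overlappingInstances false -- binders `[IsDomain O] [IsDiscreteValuationRing O]` are verbatim from p517086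

noncomputable section

open CategoryTheory AlgebraicGeometry TopologicalSpace
open AlgebraicGeometry.Scheme.IdealSheafData

namespace Summit.ResolutionOfSingularities.ResolutionOfSingularities.Cruxes.EquisingularLiftNat.Sections

/-- **(HORIZ) discharged**: for `k`, `n`, an integral `H` and a closed immersion `ι : H → ℙⁿ_k`, the (HORIZ) hypothesis of
`stub_elnat_ciNoseThenPoints_of_suppliers` — for every complete DVR `O` with algebraically closed residue field, every surjection
`π : O → k`, every graded `φ` over `π`, every `O`-SMOOTH centre `C ⊂ ℙⁿ_O` with `ι(H) ⊄ V(C · 𝒪_{ℙⁿ_k}) ⊆ ι(H)` and a point-only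
resolution of the strict transform of `ι(H)` after a blow-up of `ℙⁿ_k` along `C · 𝒪_{ℙⁿ_k}`, the horizontal `∃ (P′, σ, S′)` body holds
for `Y = (ι ≫ Proj φ)(H)` — text verbatim from p517086; proof = `horizBody_of_noseThenPoints`. [folklore; Liu 2002 §8.1/§9.2] -/
theorem ciNose_horizSupplier (k : Type) [Field k] (n : ℕ) (H : AlgebraicGeometry.Scheme.{0})
    (ι : H ⟶ (Literature.AlgebraicGeometry.Motives.projectiveSpace n k).left) (hι : AlgebraicGeometry.IsClosedImmersion ι)
    (hH : AlgebraicGeometry.IsIntegral H) :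
    ∀ (O : Type) [CommRing O] [IsDomain O] [IsDiscreteValuationRing O] [IsAdicComplete (IsLocalRing.maximalIdeal O) O] [IsAlgClosed (IsLocalRing.ResidueField O)] (π : O →+* k), Function.Surjective π → (letI := MvPolynomial.gradedAlgebra (σ := Fin (n + 1)) (R := O); letI := MvPolynomial.gradedAlgebra (σ := Fin (n + 1)) (R := k); ∀ (φ : (MvPolynomial.homogeneousSubmodule (Fin (n + 1)) O) →+*ᵍ (MvPolynomial.homogeneousSubmodule (Fin (n + 1)) k)) (hφ' : HomogeneousIdeal.irrelevant (MvPolynomial.homogeneousSubmodule (Fin (n + 1)) k) ≤ (HomogeneousIdeal.irrelevant (MvPolynomial.homogeneousSubmodule (Fin (n + 1)) O)).map φ), (∀ s, φ s = MvPolynomial.map π s) → ∀ (C : (AlgebraicGeometry.Proj (MvPolynomial.homogeneousSubmodule (Fin (n + 1)) O)).IdealSheafData), AlgebraicGeometry.Smooth (CategoryTheory.CategoryStruct.comp C.subschemeι (CategoryTheory.CategoryStruct.comp (AlgebraicGeometry.Proj.toSpecZero (MvPolynomial.homogeneousSubmodule (Fin (n + 1)) O)) (AlgebraicGeometry.Spec.map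 (CommRingCat.ofHom (algebraMap O ((MvPolynomial.homogeneousSubmodule (Fin (n + 1)) O) 0)))))) → ¬ (Set.range ι ⊆ (((C.comap (AlgebraicGeometry.Proj.map φ hφ')).support : Set (AlgebraicGeometry.Proj (MvPolynomial.homogeneousSubmodule (Fin (n + 1)) k))))) → (((C.comap (AlgebraicGeometry.Proj.map φ hφ')).support : Set (AlgebraicGeometry.Proj (MvPolynomial.homogeneousSubmodule (Fin (n + 1)) k)))) ⊆ Set.range ι → (∃ (F₂ : AlgebraicGeometry.Scheme.{0}) (υ : F₂ ⟶ (AlgebraicGeometry.Proj (MvPolynomial.homogeneousSubmodule (Fin (n + 1)) k))), Literature.AlgebraicGeometry.Resolution.IsBlowup υ (C.comap (AlgebraicGeometry.Proj.map φ hφ')) ∧ ∃ (F' : AlgebraicGeometry.Scheme.{0}) (ρ' : F' ⟶ F₂) (T' : Set F'), (∀ Q : (∀ F₁ : AlgebraicGeometry.Scheme.{0}, (F₁ ⟶ F₂) → Set F₁ → Prop), Q F₂ (CategoryTheory.CategoryStruct.id F₂) (closure (υ ⁻¹' (Set.range ι \ (((C.comap (AlgebraicGeometry.Proj.map φ hφ')).support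 : Set (AlgebraicGeometry.Proj (MvPolynomial.homogeneousSubmodule (Fin (n + 1)) k))))))) → (∀ (F₁ F₃ : AlgebraicGeometry.Scheme.{0}) (ρ : F₁ ⟶ F₂) (T₁ : Set F₁) (x : ↥((AlgebraicGeometry.Scheme.IdealSheafData.vanishingIdeal (⟨closure T₁, isClosed_closure⟩ : TopologicalSpace.Closeds F₁))).subscheme) (υ₁ : F₃ ⟶ F₁) (hx : IsClosed ({(((AlgebraicGeometry.Scheme.IdealSheafData.vanishingIdeal (⟨closure T₁, isClosed_closure⟩ : TopologicalSpace.Closeds F₁))).subschemeι x : F₁)} : Set F₁)), Q F₁ ρ T₁ → ¬ IsRegularLocalRing (((AlgebraicGeometry.Scheme.IdealSheafData.vanishingIdeal (⟨closure T₁, isClosed_closure⟩ : TopologicalSpace.Closeds F₁))).subscheme.presheaf.stalk x) → Literature.AlgebraicGeometry.Resolution.IsBlowup υ₁ (AlgebraicGeometry.Scheme.IdealSheafData.vanishingIdeal (⟨{(((AlgebraicGeometry.Scheme.IdealSheafData.vanishingIdeal (⟨closure T₁, isClosed_closure⟩ : TopologicalSpace.Closeds F₁))).subschemeι x : F₁)},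 hx⟩ : TopologicalSpace.Closeds F₁)) → Q F₃ (CategoryTheory.CategoryStruct.comp υ₁ ρ) (closure (υ₁ ⁻¹' (T₁ \ {(((AlgebraicGeometry.Scheme.IdealSheafData.vanishingIdeal (⟨closure T₁, isClosed_closure⟩ : TopologicalSpace.Closeds F₁))).subschemeι x : F₁)})))) → Q F' ρ' T') ∧ Literature.AlgebraicGeometry.Resolution.Scheme.IsRegular (AlgebraicGeometry.Scheme.IdealSheafData.vanishingIdeal (⟨closure T', isClosed_closure⟩ : TopologicalSpace.Closeds F')).subscheme) → ∀ Y : Set (AlgebraicGeometry.Proj (MvPolynomial.homogeneousSubmodule (Fin (n + 1)) O)), Y = Set.range (CategoryTheory.CategoryStruct.comp ι (AlgebraicGeometry.Proj.map φ hφ') : H ⟶ (AlgebraicGeometry.Proj (MvPolynomial.homogeneousSubmodule (Fin (n + 1)) O))) → ∃ (P' : AlgebraicGeometry.Scheme.{0}) (σ : P' ⟶ (AlgebraicGeometry.Proj (MvPolynomial.homogeneousSubmodule (Fin (n + 1)) O))) (S' : Set P'), (∀ Q : (∀ X' : AlgebraicGeometry.Scheme.{0}, (X' ⟶ (AlgebraicGeometry.Proj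 (MvPolynomial.homogeneousSubmodule (Fin (n + 1)) O))) → Set X' → Prop), Q (AlgebraicGeometry.Proj (MvPolynomial.homogeneousSubmodule (Fin (n + 1)) O)) (CategoryTheory.CategoryStruct.id (AlgebraicGeometry.Proj (MvPolynomial.homogeneousSubmodule (Fin (n + 1)) O))) Y → (∀ (X' X'' : AlgebraicGeometry.Scheme.{0}) (σ' : X' ⟶ (AlgebraicGeometry.Proj (MvPolynomial.homogeneousSubmodule (Fin (n + 1)) O))) (Y' : Set X') (C : X'.IdealSheafData) (τ : X'' ⟶ X'), Q X' σ' Y' → Literature.AlgebraicGeometry.Resolution.IsBlowup τ C → Literature.AlgebraicGeometry.Resolution.Scheme.IsRegular C.subscheme → AlgebraicGeometry.Flat (CategoryTheory.CategoryStruct.comp C.subschemeι (CategoryTheory.CategoryStruct.comp σ' (CategoryTheory.CategoryStruct.comp (AlgebraicGeometry.Proj.toSpecZero (MvPolynomial.homogeneousSubmodule (Fin (n + 1)) O)) (AlgebraicGeometry.Spec.map (CommRingCat.ofHom (algebraMap O (MvPolynomial.homogeneousSubmodule (Fin (n + 1)) O 0))))))) → σ' '' (C.support : Set X') ⊆ {x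 | ¬ IsGenericPoint x Y} → (C.support : Set X') ∩ (CategoryTheory.CategoryStruct.comp σ' (CategoryTheory.CategoryStruct.comp (AlgebraicGeometry.Proj.toSpecZero (MvPolynomial.homogeneousSubmodule (Fin (n + 1)) O)) (AlgebraicGeometry.Spec.map (CommRingCat.ofHom (algebraMap O (MvPolynomial.homogeneousSubmodule (Fin (n + 1)) O 0)))))) ⁻¹' {IsLocalRing.closedPoint O} ⊆ Y' → Q X'' (CategoryTheory.CategoryStruct.comp τ σ') (closure (τ ⁻¹' (Y' \ (C.support : Set X'))))) → Q P' σ S') ∧ Literature.AlgebraicGeometry.Resolution.Scheme.IsRegular (AlgebraicGeometry.Scheme.IdealSheafData.vanishingIdeal (⟨closure S', isClosed_closure⟩ : TopologicalSpace.Closeds P')).subscheme) := by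
  intro O _ _ _ _ _ π hπ
  letI := MvPolynomial.gradedAlgebra (σ := Fin (n + 1)) (R := O)
  letI := MvPolynomial.gradedAlgebra (σ := Fin (n + 1)) (R := k)
  intro φ hφ' hφ C hCsm hgen hsupp hdown Y hY
  haveI := hH
  let ι' : H ⟶ Proj (MvPolynomial.homogeneousSubmodule (Fin (n + 1)) k) := ι
  haveI : IsClosedImmersion ι' := hι
  exact horizBody_of_noseThenPoints O k π hπ n H ι' φ hφ' hφ C hCsm hgen hsupp hdown Y hY

/-- **CI-INST modulo (LIFT) alone**: the registered stub `stub_elnat_ciNoseThenPoints` (skeleton v6 / child v3, text verbatim) with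
ONLY res-D-pv-027's (LIFT) hypothesis inserted after the locally-principal clause — (HORIZ) is discharged by `ciNose_horizSupplier`.
The by-name closer of the registered stub is then `fun hp k _ _ _ n H ι hι hH hloc hci =>
stub_elnat_ciNoseThenPoints_of_lift p hp k n H ι hι hH hloc (LIFT_thm …) hci`. [folklore; assembly] -/
theorem stub_elnat_ciNoseThenPoints_of_lift (p : ℕ) : p.Prime → ∀ (k : Type) [Field k] [CharP k p] [IsAlgClosed k] (n : ℕ) (H : AlgebraicGeometry.Scheme.{0}) (ι : H ⟶ (Literature.AlgebraicGeometry.Motives.projectiveSpace n k).left), AlgebraicGeometry.IsClosedImmersion ι → AlgebraicGeometry.IsIntegral H → (∀ y : (Literature.AlgebraicGeometry.Motives.projectiveSpace n k).left, ∃ U : (Literature.AlgebraicGeometry.Motives.projectiveSpace n k).left.affineOpens, y ∈ (U : (Literature.AlgebraicGeometry.Motives.projectiveSpace n k).left.Opens) ∧ (ι.ker.ideal U).IsPrincipal) → (∀ (O : Type) [CommRing O] [IsDomain O] [IsDiscreteValuationRing O] [IsAdicComplete (IsLocalRing.maximalIdeal O) O] [IsAlgClosed (IsLocalRing.ResidueField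 O)] (π : O →+* k), Function.Surjective π → (letI := MvPolynomial.gradedAlgebra (σ := Fin (n + 1)) (R := O); letI := MvPolynomial.gradedAlgebra (σ := Fin (n + 1)) (R := k); ∀ (c : ℕ) (f : Fin c → MvPolynomial (Fin (n + 1)) k) (d : Fin c → ℕ), (∀ i, 1 ≤ d i ∧ f i ∈ MvPolynomial.homogeneousSubmodule (Fin (n + 1)) k (d i)) → Set.Nonempty {y : (Literature.AlgebraicGeometry.Motives.projectiveSpace n k).left | ∀ i, f i ∈ (y : ProjectiveSpectrum (MvPolynomial.homogeneousSubmodule (Fin (n + 1)) k)).asHomogeneousIdeal} → (∀ y ∈ {y : (Literature.AlgebraicGeometry.Motives.projectiveSpace n k).left | ∀ i, f i ∈ (y : ProjectiveSpectrum (MvPolynomial.homogeneousSubmodule (Fin (n + 1)) k)).asHomogeneousIdeal}, ∃ e : Fin c ↪ Fin (n + 1), Matrix.det (Matrix.of fun i j => MvPolynomial.pderiv (e j) (f i)) ∉ (y : ProjectiveSpectrum (MvPolynomial.homogeneousSubmodule (Fin (n + 1)) k)).asHomogeneousIdeal) → ∀ (hSig : IsClosed {y : (Literature.AlgebraicGeometry.Motives.projectiveSpace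 n k).left | ∀ i, f i ∈ (y : ProjectiveSpectrum (MvPolynomial.homogeneousSubmodule (Fin (n + 1)) k)).asHomogeneousIdeal}), ∃ C : (AlgebraicGeometry.Proj (MvPolynomial.homogeneousSubmodule (Fin (n + 1)) O)).IdealSheafData, AlgebraicGeometry.Smooth (CategoryTheory.CategoryStruct.comp C.subschemeι (CategoryTheory.CategoryStruct.comp (AlgebraicGeometry.Proj.toSpecZero (MvPolynomial.homogeneousSubmodule (Fin (n + 1)) O)) (AlgebraicGeometry.Spec.map (CommRingCat.ofHom (algebraMap O ((MvPolynomial.homogeneousSubmodule (Fin (n + 1)) O) 0)))))) ∧ ∀ (φ : (MvPolynomial.homogeneousSubmodule (Fin (n + 1)) O) →+*ᵍ (MvPolynomial.homogeneousSubmodule (Fin (n + 1)) k)) (hφ' : HomogeneousIdeal.irrelevant (MvPolynomial.homogeneousSubmodule (Fin (n + 1)) k) ≤ (HomogeneousIdeal.irrelevant (MvPolynomial.homogeneousSubmodule (Fin (n + 1)) O)).map φ), (∀ s, φ s = MvPolynomial.map π s) → C.comap (AlgebraicGeometry.Proj.map φ hφ') = AlgebraicGeometry.Scheme.IdealSheafData.vanishingIdeal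 (⟨{y : (Literature.AlgebraicGeometry.Motives.projectiveSpace n k).left | ∀ i, f i ∈ (y : ProjectiveSpectrum (MvPolynomial.homogeneousSubmodule (Fin (n + 1)) k)).asHomogeneousIdeal}, hSig⟩ : TopologicalSpace.Closeds (Literature.AlgebraicGeometry.Motives.projectiveSpace n k).left))) → (letI := MvPolynomial.gradedAlgebra (σ := Fin (n + 1)) (R := k); ∃ (c : ℕ) (f : Fin c → MvPolynomial (Fin (n + 1)) k) (d : Fin c → ℕ), (∀ i, 1 ≤ d i ∧ f i ∈ MvPolynomial.homogeneousSubmodule (Fin (n + 1)) k (d i)) ∧ Set.Nonempty {y : (Literature.AlgebraicGeometry.Motives.projectiveSpace n k).left | ∀ i, f i ∈ (y : ProjectiveSpectrum (MvPolynomial.homogeneousSubmodule (Fin (n + 1)) k)).asHomogeneousIdeal} ∧ {y : (Literature.AlgebraicGeometry.Motives.projectiveSpace n k).left | ∀ i, f i ∈ (y : ProjectiveSpectrum (MvPolynomial.homogeneousSubmodule (Fin (n + 1)) k)).asHomogeneousIdeal} ⊆ Set.range ι ∧ ¬ (Set.range ι ⊆ {y : (Literature.AlgebraicGeometry.Motives.projectiveSpace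 n k).left | ∀ i, f i ∈ (y : ProjectiveSpectrum (MvPolynomial.homogeneousSubmodule (Fin (n + 1)) k)).asHomogeneousIdeal}) ∧ (∀ y ∈ {y : (Literature.AlgebraicGeometry.Motives.projectiveSpace n k).left | ∀ i, f i ∈ (y : ProjectiveSpectrum (MvPolynomial.homogeneousSubmodule (Fin (n + 1)) k)).asHomogeneousIdeal}, ∃ e : Fin c ↪ Fin (n + 1), Matrix.det (Matrix.of fun i j => MvPolynomial.pderiv (e j) (f i)) ∉ (y : ProjectiveSpectrum (MvPolynomial.homogeneousSubmodule (Fin (n + 1)) k)).asHomogeneousIdeal) ∧ ∃ (hSig : IsClosed {y : (Literature.AlgebraicGeometry.Motives.projectiveSpace n k).left | ∀ i, f i ∈ (y : ProjectiveSpectrum (MvPolynomial.homogeneousSubmodule (Fin (n + 1)) k)).asHomogeneousIdeal}) (F₂ : AlgebraicGeometry.Scheme.{0}) (υ : F₂ ⟶ (Literature.AlgebraicGeometry.Motives.projectiveSpace n k).left), Literature.AlgebraicGeometry.Resolution.IsBlowup υ (AlgebraicGeometry.Scheme.IdealSheafData.vanishingIdeal (⟨{y : (Literature.AlgebraicGeometry.Motives.projectiveSpace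 n k).left | ∀ i, f i ∈ (y : ProjectiveSpectrum (MvPolynomial.homogeneousSubmodule (Fin (n + 1)) k)).asHomogeneousIdeal}, hSig⟩ : TopologicalSpace.Closeds (Literature.AlgebraicGeometry.Motives.projectiveSpace n k).left)) ∧ ∃ (F' : AlgebraicGeometry.Scheme.{0}) (ρ' : F' ⟶ F₂) (T' : Set F'), (∀ Q : (∀ F₁ : AlgebraicGeometry.Scheme.{0}, (F₁ ⟶ F₂) → Set F₁ → Prop), Q F₂ (CategoryTheory.CategoryStruct.id F₂) (closure (υ ⁻¹' (Set.range ι \ {y : (Literature.AlgebraicGeometry.Motives.projectiveSpace n k).left | ∀ i, f i ∈ (y : ProjectiveSpectrum (MvPolynomial.homogeneousSubmodule (Fin (n + 1)) k)).asHomogeneousIdeal}))) → (∀ (F₁ F₃ : AlgebraicGeometry.Scheme.{0}) (ρ : F₁ ⟶ F₂) (T₁ : Set F₁) (x : ↥((AlgebraicGeometry.Scheme.IdealSheafData.vanishingIdeal (⟨closure T₁, isClosed_closure⟩ : TopologicalSpace.Closeds F₁))).subscheme) (υ₁ : F₃ ⟶ F₁) (hx : IsClosed ({(((AlgebraicGeometry.Scheme.IdealSheafData.vanishingIdeal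 (⟨closure T₁, isClosed_closure⟩ : TopologicalSpace.Closeds F₁))).subschemeι x : F₁)} : Set F₁)), Q F₁ ρ T₁ → ¬ IsRegularLocalRing (((AlgebraicGeometry.Scheme.IdealSheafData.vanishingIdeal (⟨closure T₁, isClosed_closure⟩ : TopologicalSpace.Closeds F₁))).subscheme.presheaf.stalk x) → Literature.AlgebraicGeometry.Resolution.IsBlowup υ₁ (AlgebraicGeometry.Scheme.IdealSheafData.vanishingIdeal (⟨{(((AlgebraicGeometry.Scheme.IdealSheafData.vanishingIdeal (⟨closure T₁, isClosed_closure⟩ : TopologicalSpace.Closeds F₁))).subschemeι x : F₁)}, hx⟩ : TopologicalSpace.Closeds F₁)) → Q F₃ (CategoryTheory.CategoryStruct.comp υ₁ ρ) (closure (υ₁ ⁻¹' (T₁ \ {(((AlgebraicGeometry.Scheme.IdealSheafData.vanishingIdeal (⟨closure T₁, isClosed_closure⟩ : TopologicalSpace.Closeds F₁))).subschemeι x : F₁)})))) → Q F' ρ' T') ∧ Literature.AlgebraicGeometry.Resolution.Scheme.IsRegular (AlgebraicGeometry.Scheme.IdealSheafData.vanishingIdeal (⟨closure T', isClosed_closure⟩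 : TopologicalSpace.Closeds F')).subscheme) → ∃ (O : Type) (_ : CommRing O) (_ : IsDomain O) (_ : IsDiscreteValuationRing O) (_ : CharZero O) (π : O →+* k), Function.Surjective π ∧ (letI := MvPolynomial.gradedAlgebra (σ := Fin (n + 1)) (R := O); letI := MvPolynomial.gradedAlgebra (σ := Fin (n + 1)) (R := k); ∀ (φ : MvPolynomial.homogeneousSubmodule (Fin (n + 1)) O →+*ᵍ MvPolynomial.homogeneousSubmodule (Fin (n + 1)) k) (hφ' : HomogeneousIdeal.irrelevant (MvPolynomial.homogeneousSubmodule (Fin (n + 1)) k) ≤ (HomogeneousIdeal.irrelevant (MvPolynomial.homogeneousSubmodule (Fin (n + 1)) O)).map φ), (∀ s, φ s = MvPolynomial.map π s) → ∀ Y : Set (AlgebraicGeometry.Proj (MvPolynomial.homogeneousSubmodule (Fin (n + 1)) O)), Y = Set.range (CategoryTheory.CategoryStruct.comp ι (AlgebraicGeometry.Proj.map φ hφ') : H ⟶ (AlgebraicGeometry.Proj (MvPolynomial.homogeneousSubmodule (Fin (n + 1)) O))) → ∃ (P' : AlgebraicGeometry.Scheme.{0}) (σ : P' ⟶ (AlgebraicGeometry.Proj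 (MvPolynomial.homogeneousSubmodule (Fin (n + 1)) O))) (S' : Set P'), (∀ Q : (∀ X' : AlgebraicGeometry.Scheme.{0}, (X' ⟶ (AlgebraicGeometry.Proj (MvPolynomial.homogeneousSubmodule (Fin (n + 1)) O))) → Set X' → Prop), Q (AlgebraicGeometry.Proj (MvPolynomial.homogeneousSubmodule (Fin (n + 1)) O)) (CategoryTheory.CategoryStruct.id (AlgebraicGeometry.Proj (MvPolynomial.homogeneousSubmodule (Fin (n + 1)) O))) Y → (∀ (X' X'' : AlgebraicGeometry.Scheme.{0}) (σ' : X' ⟶ (AlgebraicGeometry.Proj (MvPolynomial.homogeneousSubmodule (Fin (n + 1)) O))) (Y' : Set X') (C : X'.IdealSheafData) (τ : X'' ⟶ X'), Q X' σ' Y' → Literature.AlgebraicGeometry.Resolution.IsBlowup τ C → Literature.AlgebraicGeometry.Resolution.Scheme.IsRegular C.subscheme → AlgebraicGeometry.Flat (CategoryTheory.CategoryStruct.comp C.subschemeι (CategoryTheory.CategoryStruct.comp σ' (CategoryTheory.CategoryStruct.comp (AlgebraicGeometry.Proj.toSpecZero (MvPolynomial.homogeneousSubmodule (Fin (n + 1))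 O)) (AlgebraicGeometry.Spec.map (CommRingCat.ofHom (algebraMap O (MvPolynomial.homogeneousSubmodule (Fin (n + 1)) O 0))))))) → σ' '' (C.support : Set X') ⊆ {x | ¬ IsGenericPoint x Y} → (C.support : Set X') ∩ (CategoryTheory.CategoryStruct.comp σ' (CategoryTheory.CategoryStruct.comp (AlgebraicGeometry.Proj.toSpecZero (MvPolynomial.homogeneousSubmodule (Fin (n + 1)) O)) (AlgebraicGeometry.Spec.map (CommRingCat.ofHom (algebraMap O (MvPolynomial.homogeneousSubmodule (Fin (n + 1)) O 0)))))) ⁻¹' {IsLocalRing.closedPoint O} ⊆ Y' → Q X'' (CategoryTheory.CategoryStruct.comp τ σ') (closure (τ ⁻¹' (Y' \ (C.support : Set X'))))) → Q P' σ S') ∧ Literature.AlgebraicGeometry.Resolution.Scheme.IsRegular (AlgebraicGeometry.Scheme.IdealSheafData.vanishingIdeal (⟨closure S', isClosed_closure⟩ : TopologicalSpace.Closeds P')).subscheme) := by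
  intro hp k _ _ _ n H ι hι hH hloc hLIFT hci
  exact stub_elnat_ciNoseThenPoints_of_suppliers p hp k n H ι hι hH hloc hLIFT (ciNose_horizSupplier k n H ι hι hH) hci

end Summit.ResolutionOfSingularities.ResolutionOfSingularities.Cruxes.EquisingularLiftNat.Sections

end
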